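import Literature.Topology.FourManifolds.CollarUniquenessBall
import HarnessLib

/-!
# Uniqueness of collars of `∂𝔻` in families: the splice with a parameter

Topic `Literature/Topology/FourManifolds`. `CollarUniquenessBall.lean` proves, for ONE inner
collar `θ` of the unit sphere in a finite-dimensional real inner product space `E`
(`Literature.Topology.FourManifolds.IsInnerCollar`), that the **splice**
`Θ_L = id + ρ_L(1 - ‖x‖) • (θ - id)` of `θ` with the identity along the log-slow cutoff `ρ_L`
(`Literature.Topology.FourManifolds.IsInnerCollar.splice`) is, for `L` large
(`Literature.Topology.FourManifolds.IsInnerCollar.SpliceHyp`), a `C^∞` diffeomorphism of the open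
unit ball agreeing with `θ` near the sphere and with the identity inside (Hirsch, *Differential
Topology* (1976), Ch. 8, Thm. 1.8: uniqueness of collars). This file proves the **parametric
form** needed to flatten *paths* of diffeomorphisms of the disc along the boundary (Cerf, *Sur les
difféomorphismes de la sphère de dimension trois*, LNM 53 (1968), Appendice §2, Proposition 1:
`π_i Diff(V; J^r_{∂V}) ≅ π_i Diff(V; ∂V)`, case `i = 0`, `V = Dⁿ`, in
`CerfAppendixPropositionOne.lean`):

* `IsInnerCollar.lower_radial_of_lipschitz_sub` — **stability of the splice constants**: if `θ₀`
  has a uniform lower bound `c` for its blends and a radial Lipschitz constant `C₁` on a shell,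
  then every inner collar `θ` with `θ - θ₀` `(c/2)`-Lipschitz on the closed unit ball has the
  constants `c/2`, `C₁ + c/2` on the same shell;
* `exists_forall_spliceHyp_of_isCompact` — **one `L` for a compact family**: for a jointly `C¹`
  family `θ_p` (`p` in a finite-dimensional parameter space) of inner collars over a compact set
  `K` of parameters there is `L ≥ 1` with `SpliceHyp ε (θ p) … L` for every `p ∈ K` (the
  constants vary with `p`, the cutoff scale `L` does not);
* `contDiffAt_splice_family` — the spliced family `(p, x) ↦ Θ_p x` is jointly `C^∞` on
  `P × 𝔹`;
* `exists_spliceInverse_family` — and so is the family of inverses `(p, y) ↦ Θ_p⁻¹ y` on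
  `V × 𝔹` for every open set `V` of good parameters (inverse function theorem for the track
  `(p, x) ↦ (p, Θ_p x)`), packaged with the algebraic identities and the two localisation
  properties (`Θ_p = θ_p` on the shell `1 - e^{-2L} ≤ ‖x‖ < 1`, `Θ_p = id` on
  `‖x‖ ≤ 1 - e^{-L}`).

Everything is proved; there are no definitions of new notions and no named facts.

## References

* M. W. Hirsch, *Differential Topology*, GTM 33, Springer (1976), Ch. 8, Thm. 1.8 and the remark
  following it (uniqueness of collars, with parameters: Thm. 1.6/1.7 pattern). [HirschDT1976]
* J. Cerf, *Sur les difféomorphismes de la sphère de dimension trois (Γ₄ = 0)*, Lecture Notes in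
  Mathematics 53, Springer (1968), Appendice §2, Proposition 1. [CerfDiffeoSphere1968]
-/

open scoped Topology ContDiff
open Set Function Metric Filter Real
open scoped InnerProductSpace RealInnerProductSpace

noncomputable section

namespace Literature.Topology.FourManifolds

namespace IsInnerCollar

section Perturbation

variable {E : Type*} [NormedAddCommGroup E] [InnerProductSpace ℝ E]

/-- **Stability of the splice constants under Lipschitz-small perturbations.** Let `θ₀` fix the
unit sphere pointwise, with a uniform lower bound `c` for its blends `id + t(θ₀ - id)`,
`t ∈ [0, 1]`, and the radial bound `‖θ₀ x - x‖ ≤ C₁ (1 - ‖x‖)`, on the closed shell of width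
`ε₃`; let `θ` be an inner collar of width `ε > ε₃` such that `θ - θ₀` is `κ`-Lipschitz on the
closed unit ball with `2κ ≤ c`. Then the blends of `θ` have the lower bound `c / 2` and
`‖θ x - x‖ ≤ (C₁ + κ + 1)(1 - ‖x‖)` on the same shell. [folklore] -/
theorem lower_radial_of_lipschitz_sub {ε ε₃ c C₁ κ : ℝ} {θ₀ θ θinv : E → E}
    (h : IsInnerCollar ε θ θinv) (hε₃ε : ε₃ ≤ ε) (hθ₀ : ∀ x : E, ‖x‖ = 1 → θ₀ x = x)
    (hlower : ∀ t ∈ Icc (0 : ℝ) 1, ∀ x ∈ (closedShell ε₃ : Set E), ∀ y ∈ (closedShell ε₃ : Set E),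
      c * ‖x - y‖ ≤ ‖(x + t • (θ₀ x - x)) - (y + t • (θ₀ y - y))‖)
    (hradial : ∀ x ∈ (closedShell ε₃ : Set E), ‖θ₀ x - x‖ ≤ C₁ * (1 - ‖x‖))
    (hC₁ : 0 ≤ C₁) (hκ : 0 ≤ κ) (hκc : 2 * κ ≤ c)
    (hdiff : ∀ x ∈ closedBall (0 : E) 1, ∀ y ∈ closedBall (0 : E) 1,
      ‖(θ x - θ₀ x) - (θ y - θ₀ y)‖ ≤ κ * ‖x - y‖) :
    (∀ t ∈ Icc (0 : ℝ) 1, ∀ x ∈ (closedShell ε₃ : Set E), ∀ y ∈ (closedShell ε₃ : Set E),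
      c / 2 * ‖x - y‖ ≤ ‖(x + t • (θ x - x)) - (y + t • (θ y - y))‖) ∧
    (∀ x ∈ (closedShell ε₃ : Set E), ‖θ x - x‖ ≤ (C₁ + κ + 1) * (1 - ‖x‖)) := by
  constructor
  · intro t ht x hx y hy
    have hxb : x ∈ closedBall (0 : E) 1 := closedShell_subset_closedBall hx
    have hyb : y ∈ closedBall (0 : E) 1 := closedShell_subset_closedBall hy
    have h0 := hlower t ht x hx y hy
    have h1 := hdiff x hxb y hyb
    -- `B_t^θ x - B_t^θ y = (B_t^{θ₀} x - B_t^{θ₀} y) + t • ((θ - θ₀) x - (θ - θ₀) y)`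
    have heq : (x + t • (θ x - x)) - (y + t • (θ y - y)) =
        ((x + t • (θ₀ x - x)) - (y + t • (θ₀ y - y))) + t • ((θ x - θ₀ x) - (θ y - θ₀ y)) := by
      module
    rw [heq]
    have ht1 : ‖t • ((θ x - θ₀ x) - (θ y - θ₀ y))‖ ≤ κ * ‖x - y‖ := by
      rw [norm_smul, Real.norm_of_nonneg ht.1]
      calc t * ‖(θ x - θ₀ x) - (θ y - θ₀ y)‖ ≤ 1 * (κ * ‖x - y‖) := by
            gcongr
            · exact ht.2
        _ = κ * ‖x - y‖ := one_mul _
    -- `‖a‖ - ‖b‖ ≤ ‖a + b‖`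
    set a : E := (x + t • (θ₀ x - x)) - (y + t • (θ₀ y - y)) with ha
    set b : E := t • ((θ x - θ₀ x) - (θ y - θ₀ y)) with hb
    have h2 : ‖a‖ - ‖b‖ ≤ ‖a + b‖ := by
      have := norm_sub_le (a + b) b
      rw [add_sub_cancel_right] at this
      linarith
    have hnn : 0 ≤ ‖x - y‖ := norm_nonneg _
    nlinarith [h0, h1, ht1, h2, hnn, hκc]
  · intro x hx
    have hx1 : ‖x‖ ≤ 1 := (mem_closedShell_iff.1 hx).2
    have hxb : x ∈ closedBall (0 : E) 1 := closedShell_subset_closedBall hx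
    by_cases hx0 : x = 0
    · subst hx0
      have : ‖θ 0‖ ≤ 1 := h.norm_le_one 0 (closedShell_mono hε₃ε hx)
      simp only [sub_zero, norm_zero]
      nlinarith
    have hnx : 0 < ‖x‖ := norm_pos_iff.2 hx0
    set xh : E := ‖x‖⁻¹ • x with hxh
    have hxh1 : ‖xh‖ = 1 := by
      rw [hxh, norm_smul, norm_inv, norm_norm, inv_mul_cancel₀ hnx.ne']
    have hxhb : xh ∈ closedBall (0 : E) 1 := mem_closedBall_zero_iff.2 hxh1.le
    have hθxh : θ xh = xh := h.eq_self xh hxh1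
    have hθ₀xh : θ₀ xh = xh := hθ₀ xh hxh1
    have hdiff' := hdiff x hxb xh hxhb
    rw [hθxh, hθ₀xh, sub_self, sub_zero] at hdiff'
    have hnd : ‖x - xh‖ = 1 - ‖x‖ := by
      have hd : x - xh = (‖x‖ - 1) • xh := by
        rw [hxh, smul_smul, sub_mul, mul_inv_cancel₀ hnx.ne', one_mul, sub_smul, one_smul]
      rw [hd, norm_smul, hxh1, mul_one, Real.norm_eq_abs, abs_sub_comm, abs_of_nonneg (by linarith)]
    rw [hnd] at hdiff'
    have hr := hradial x hx
    have heq : θ x - x = (θ₀ x - x) + (θ x - θ₀ x) := by abel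
    rw [heq]
    have h01 : 0 ≤ 1 - ‖x‖ := by linarith
    calc ‖(θ₀ x - x) + (θ x - θ₀ x)‖ ≤ ‖θ₀ x - x‖ + ‖θ x - θ₀ x‖ := norm_add_le _ _
      _ ≤ C₁ * (1 - ‖x‖) + κ * (1 - ‖x‖) := add_le_add hr hdiff'
      _ ≤ (C₁ + κ + 1) * (1 - ‖x‖) := by nlinarith

end Perturbation

/-! ### One cutoff scale for a compact family of collars -/

section Families

variable {E : Type*} [NormedAddCommGroup E] [InnerProductSpace ℝ E] [FiniteDimensional ℝ E]
  {P : Type*} [NormedAddCommGroup P] [NormedSpace ℝ P] [FiniteDimensional ℝ P]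
  {θf θinv : P → E → E} {ε : ℝ} {K : Set P}

omit [FiniteDimensional ℝ E] [FiniteDimensional ℝ P] in
/-- The derivative of a member `θ_p` of a jointly `C¹` family, as the partial derivative of the
family (chain rule along `x ↦ (p, x)`). [folklore] -/
theorem hasFDerivAt_family (hF : ContDiff ℝ 1 fun q : P × E => θf q.1 q.2) (p : P) (x : E) :
    HasFDerivAt (θf p) ((fderiv ℝ (fun q : P × E => θf q.1 q.2) (p, x)).comp
      (ContinuousLinearMap.inr ℝ P E)) x := by
  have h1 : HasFDerivAt (fun q : P × E => θf q.1 q.2)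
      (fderiv ℝ (fun q : P × E => θf q.1 q.2) (p, x)) (p, x) :=
    ((hF.differentiable one_ne_zero) (p, x)).hasFDerivAt
  exact h1.comp x (hasFDerivAt_prodMk_right p x)

omit [FiniteDimensional ℝ E] [FiniteDimensional ℝ P] in
/-- The partial derivative `(p, x) ↦ D(θ_p)(x)` of a jointly `C¹` family is jointly continuous.
[folklore] -/
theorem continuous_fderiv_family (hF : ContDiff ℝ 1 fun q : P × E => θf q.1 q.2) :
    Continuous fun q : P × E => fderiv ℝ (θf q.1) q.2 := by
  have heq : (fun q : P × E => fderiv ℝ (θf q.1) q.2) = fun q : P × E =>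
      (fderiv ℝ (fun q : P × E => θf q.1 q.2) q).comp (ContinuousLinearMap.inr ℝ P E) := by
    funext q
    exact (hasFDerivAt_family hF q.1 q.2).fderiv
  rw [heq]
  exact (hF.continuous_fderiv one_ne_zero).clm_comp continuous_const

/-- **Local uniformity of the splice constants.** Near every parameter `p₀ ∈ K` of a jointly `C¹`
family of inner collars there are a neighbourhood `U` and a threshold `L₀` such that
`SpliceHyp ε (θ p) ε₃ c C₁ L` holds, with constants depending only on `p₀`, for all `p ∈ U ∩ K`
and all `L ≥ L₀`: the constants of `θ_{p₀}` (`exists_lower_bound_blend`,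
`exists_norm_sub_self_le`) survive, halved, a `(c/2)`-Lipschitz perturbation on the closed ball
(`lower_radial_of_lipschitz_sub`), and `θ_p - θ_{p₀}` is that small for `p` near `p₀` by uniform
continuity of `D(θ_p)` on a compact set and the mean value inequality. [folklore] -/
theorem exists_local_spliceHyp (hF : ContDiff ℝ 1 fun q : P × E => θf q.1 q.2)
    (hK : ∀ p ∈ K, IsInnerCollar ε (θf p) (θinv p)) {p₀ : P} (hp₀ : p₀ ∈ K) :
    ∃ L₀ : ℝ, ∃ U ∈ 𝓝 p₀, ∀ L, L₀ ≤ L → ∀ p ∈ U, p ∈ K →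
      ∃ ε₃ c C₁ : ℝ, SpliceHyp ε (θf p) ε₃ c C₁ L := by
  obtain ⟨ε₃, c, hε₃, hε₃ε, hc, hlow⟩ := (hK p₀ hp₀).exists_lower_bound_blend
  obtain ⟨C₁, hC₁, hrad⟩ := (hK p₀ hp₀).exists_norm_sub_self_le hε₃ε
  set κ : ℝ := c / 2 with hκ
  have hκpos : 0 < κ := by positivity
  -- uniform continuity of the partial derivative on `B̄(p₀, 1) × B̄(0, 1)`
  set φ : P × E → E →L[ℝ] E := fun q => fderiv ℝ (θf q.1) q.2 with hφ
  have hφc : Continuous φ := continuous_fderiv_family hF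
  set S : Set (P × E) := closedBall p₀ 1 ×ˢ closedBall (0 : E) 1 with hS
  have hSc : IsCompact S := (isCompact_closedBall p₀ 1).prod (isCompact_closedBall 0 1)
  have huc : UniformContinuousOn φ S := hSc.uniformContinuousOn_of_continuous hφc.continuousOn
  obtain ⟨δ, hδ, hδφ⟩ := Metric.uniformContinuousOn_iff_le.1 huc κ hκpos
  set U : Set P := ball p₀ (min δ 1) with hU
  have hUn : U ∈ 𝓝 p₀ := ball_mem_nhds _ (lt_min hδ one_pos)
  -- the derivative of `θ_p - θ_{p₀}` is `≤ κ` on the closed unit ball for `p ∈ U`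
  have hder : ∀ p ∈ U, ∀ z ∈ closedBall (0 : E) 1, ‖φ (p, z) - φ (p₀, z)‖ ≤ κ := by
    intro p hp z hz
    have hp1 : p ∈ closedBall p₀ 1 :=
      mem_closedBall.2 (le_of_lt ((mem_ball.1 hp).trans_le (min_le_right _ _)))
    have ha : (p, z) ∈ S := ⟨hp1, hz⟩
    have hb : (p₀, z) ∈ S := ⟨mem_closedBall_self zero_le_one, hz⟩
    have hdist : dist (p, z) (p₀, z) ≤ δ := by
      rw [Prod.dist_eq, dist_self, max_eq_left dist_nonneg]
      exact le_of_lt ((mem_ball.1 hp).trans_le (min_le_left _ _))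
    have := hδφ (p, z) ha (p₀, z) hb hdist
    rwa [dist_eq_norm] at this
  -- hence `θ_p - θ_{p₀}` is `κ`-Lipschitz on the closed unit ball
  have hdiff : ∀ p ∈ U, ∀ x ∈ closedBall (0 : E) 1, ∀ y ∈ closedBall (0 : E) 1,
      ‖(θf p x - θf p₀ x) - (θf p y - θf p₀ y)‖ ≤ κ * ‖x - y‖ := by
    intro p hp x hx y hy
    have hd : ∀ z ∈ closedBall (0 : E) 1, HasFDerivWithinAt (fun w => θf p w - θf p₀ w)
        (φ (p, z) - φ (p₀, z)) (closedBall (0 : E) 1) z := fun z _ =>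
      (((hasFDerivAt_family hF p z).sub (hasFDerivAt_family hF p₀ z)).congr_fderiv (by
        simp only [hφ]
        rw [(hasFDerivAt_family hF p z).fderiv, (hasFDerivAt_family hF p₀ z).fderiv])).hasFDerivWithinAt
    exact (convex_closedBall (0 : E) 1).norm_image_sub_le_of_norm_hasFDerivWithin_le hd
      (fun z hz => hder p hp z hz) hy hx
  -- the constants `(ε₃, c/2, C₁ + κ + 1)` work for every `p ∈ U ∩ K`
  set C₁' : ℝ := C₁ + κ + 1 with hC₁'
  have hC₁'pos : 0 < C₁' := by positivity
  have hgood : ∀ p ∈ U, p ∈ K →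
      (∀ t ∈ Icc (0 : ℝ) 1, ∀ x ∈ (closedShell ε₃ : Set E), ∀ y ∈ (closedShell ε₃ : Set E),
        c / 2 * ‖x - y‖ ≤ ‖(x + t • (θf p x - x)) - (y + t • (θf p y - y))‖) ∧
      (∀ x ∈ (closedShell ε₃ : Set E), ‖θf p x - x‖ ≤ C₁' * (1 - ‖x‖)) := fun p hpU hpK =>
    (hK p hpK).lower_radial_of_lipschitz_sub hε₃ε.le (hK p₀ hp₀).eq_self hlow hrad hC₁.le
      hκpos.le (by rw [hκ]; linarith) (hdiff p hpU)
  -- `L → ∞`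
  have ev1 : ∀ᶠ L : ℝ in atTop, (1 + C₁') * exp (-L) < ε₃ := by
    have : Tendsto (fun L : ℝ => (1 + C₁') * exp (-L)) atTop (𝓝 ((1 + C₁') * 0)) :=
      tendsto_exp_neg_atTop_nhds_zero.const_mul _
    rw [mul_zero] at this
    exact this.eventually (eventually_lt_nhds hε₃)
  have ev2 : ∀ᶠ L : ℝ in atTop, smoothTransitionDerivBound * C₁' / L ≤ c / 2 / 2 := by
    have : Tendsto (fun L : ℝ => smoothTransitionDerivBound * C₁' / L) atTop (𝓝 0) :=
      tendsto_const_nhds.div_atTop tendsto_id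
    exact (this.eventually (eventually_lt_nhds (by positivity : (0 : ℝ) < c / 2 / 2))).mono
      fun L hL => le_of_lt hL
  obtain ⟨L₀, hL₀⟩ := eventually_atTop.1 ((ev1.and ev2).and (eventually_gt_atTop 0))
  refine ⟨L₀, U, hUn, fun L hL p hpU hpK => ⟨ε₃, c / 2, C₁', ?_⟩⟩
  obtain ⟨⟨h1, h2⟩, h3⟩ := hL₀ L hL
  obtain ⟨hl, hr⟩ := hgood p hpU hpK
  exact ⟨hε₃, hε₃ε, by positivity, hC₁'pos, hl, hr, h3, h1, h2⟩

/-- **One cutoff scale for a compact family** (Hirsch's uniqueness of collars with parameters,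
in the tree's ambient form). For a jointly `C¹` family `θ_p` of inner collars of the unit sphere,
`p` ranging over a compact set `K` of a finite-dimensional parameter space, there is a single
`L ≥ 1` such that for every `p ∈ K` the splice `Θ_{p} = id + ρ_L(1 - ‖x‖)(θ_p - id)` satisfies
the hypotheses `SpliceHyp` of `CollarUniquenessBall.lean` (and so is a diffeomorphism of the open
ball equal to `θ_p` on `{1 - e^{-2L} ≤ ‖x‖ < 1}` and to the identity on `{‖x‖ ≤ 1 - e^{-L}}`).
Finitely many of the neighbourhoods of `exists_local_spliceHyp` cover `K`, and the conditions on
`L` are monotone. [cite: HirschDT1976, Ch. 8 Thm. 1.8] -/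
theorem exists_forall_spliceHyp_of_isCompact (hF : ContDiff ℝ 1 fun q : P × E => θf q.1 q.2)
    (hKc : IsCompact K) (hK : ∀ p ∈ K, IsInnerCollar ε (θf p) (θinv p)) :
    ∃ L : ℝ, 1 ≤ L ∧ ∀ p ∈ K, ∃ ε₃ c C₁ : ℝ, SpliceHyp ε (θf p) ε₃ c C₁ L := by
  choose! L₀ U hU hgood using fun p₀ hp₀ => exists_local_spliceHyp hF hK (p₀ := p₀) hp₀
  obtain ⟨t, htK, hcover⟩ := hKc.elim_nhds_subcover U hU
  set L : ℝ := 1 + ∑ p ∈ t, |L₀ p| with hL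
  have hsum : 0 ≤ ∑ p ∈ t, |L₀ p| := Finset.sum_nonneg fun p _ => abs_nonneg _
  refine ⟨L, by linarith, fun p hpK => ?_⟩
  obtain ⟨i, hi, hpi⟩ := mem_iUnion₂.1 (hcover hpK)
  have hLi : L₀ i ≤ L := by
    have h1 : |L₀ i| ≤ ∑ p ∈ t, |L₀ p| :=
      Finset.single_le_sum (fun p _ => abs_nonneg (L₀ p)) hi
    linarith [le_abs_self (L₀ i)]
  exact hgood i (htK i hi) L hLi p hpi hpK

/-! ### Joint smoothness of the spliced family and of its inverse -/

omit [FiniteDimensional ℝ E] [FiniteDimensional ℝ P] in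
/-- **The spliced family is jointly `C^∞` on `P × 𝔹`** (for a jointly `C^∞` family `θ_p` on
`P × E`): inside `‖x‖ < 1 - e^{-L}` it is the second projection, elsewhere on the open ball it is
built from smooth operations (`‖x‖ ≠ 0`, `1 - ‖x‖ ≠ 0`). [folklore] -/
theorem contDiffAt_splice_family (hF : ContDiff ℝ ∞ fun q : P × E => θf q.1 q.2) {L : ℝ}
    (hL : 0 < L) {q : P × E} (hq : ‖q.2‖ < 1) :
    ContDiffAt ℝ ∞ (fun q : P × E => splice (θf q.1) L q.2) q := by
  by_cases hq' : ‖q.2‖ < 1 - exp (-L)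
  · have hev : (fun q : P × E => splice (θf q.1) L q.2) =ᶠ[𝓝 q] fun q => q.2 := by
      have ho : IsOpen {q : P × E | ‖q.2‖ < 1 - exp (-L)} :=
        isOpen_lt (continuous_norm.comp continuous_snd) continuous_const
      filter_upwards [ho.mem_nhds hq'] with r hr
      exact splice_eq_self hL (le_of_lt hr)
    exact contDiffAt_snd.congr_of_eventuallyEq hev
  · have hqn : 1 - exp (-L) ≤ ‖q.2‖ := not_lt.1 hq'
    have hq0 : q.2 ≠ 0 := by
      intro h0
      rw [h0, norm_zero] at hqn
      linarith [exp_lt_one_iff.2 (neg_lt_zero.2 hL)]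
    have hn : ContDiffAt ℝ ∞ (fun r : P × E => ‖r.2‖) q :=
      (contDiffAt_norm ℝ hq0).comp q contDiffAt_snd
    have hρ : ContDiffAt ℝ ∞ (fun r : P × E => logCutoff L (1 - ‖r.2‖)) q :=
      (contDiffAt_logCutoff (by linarith)).comp q (contDiffAt_const.sub hn)
    exact contDiffAt_snd.add (hρ.smul (hF.contDiffAt.sub contDiffAt_snd))

omit [FiniteDimensional ℝ E] [FiniteDimensional ℝ P] in
/-- The track `(p, x) ↦ (p, Θ_p x)` of the spliced family is `C^∞` at points of `P × 𝔹`.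
[folklore] -/
theorem contDiffAt_spliceTrack (hF : ContDiff ℝ ∞ fun q : P × E => θf q.1 q.2) {L : ℝ}
    (hL : 0 < L) {q : P × E} (hq : ‖q.2‖ < 1) :
    ContDiffAt ℝ ∞ (fun q : P × E => (q.1, splice (θf q.1) L q.2)) q :=
  contDiffAt_fst.prodMk (contDiffAt_splice_family hF hL hq)

/-- **The derivative of the track is invertible** at a point `(p, x)` of `P × 𝔹` where
`SpliceHyp` holds for `θ_p`: it is block lower-triangular with diagonal blocks the identity of
`P` and the (uniformly injective) derivative of `Θ_p` (`SpliceHyp.exists_hasFDerivAt_lower`).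
[folklore] -/
theorem exists_hasFDerivAt_spliceTrack_equiv (hF : ContDiff ℝ ∞ fun q : P × E => θf q.1 q.2)
    {L ε₃ c C₁ : ℝ} {p : P} (h : IsInnerCollar ε (θf p) (θinv p))
    (hs : SpliceHyp ε (θf p) ε₃ c C₁ L) {x : E} (hx : ‖x‖ < 1) :
    ∃ M : (P × E) ≃L[ℝ] (P × E),
      HasFDerivAt (fun q : P × E => (q.1, splice (θf q.1) L q.2)) (M : P × E →L[ℝ] P × E) (p, x) := by
  set T : P × E → P × E := fun q => (q.1, splice (θf q.1) L q.2) with hT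
  set S : P × E → E := fun q => splice (θf q.1) L q.2 with hS
  have hSd : HasFDerivAt S (fderiv ℝ S (p, x)) (p, x) :=
    ((contDiffAt_splice_family hF hs.L_pos (q := (p, x)) hx).differentiableAt (by simp)).hasFDerivAt
  have hTd : HasFDerivAt T ((ContinuousLinearMap.fst ℝ P E).prod (fderiv ℝ S (p, x))) (p, x) :=
    hasFDerivAt_fst.prodMk hSd
  -- the partial derivative in `x` is the derivative of `Θ_p`, injective
  obtain ⟨D, hD, hDlow⟩ := hs.exists_hasFDerivAt_lower h hx
  have hpart : (fderiv ℝ S (p, x)).comp (ContinuousLinearMap.inr ℝ P E) = D := by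
    have h1 : HasFDerivAt (fun y : E => S (p, y)) ((fderiv ℝ S (p, x)).comp
        (ContinuousLinearMap.inr ℝ P E)) x := hSd.comp x (hasFDerivAt_prodMk_right p x)
    exact h1.unique hD
  have hm : 0 < min (c / 2) 1 := lt_min (by linarith [hs.c_pos]) one_pos
  have hinj : Injective ((ContinuousLinearMap.fst ℝ P E).prod (fderiv ℝ S (p, x))) := by
    refine (injective_iff_map_eq_zero _).2 fun v hv => ?_
    obtain ⟨v₁, v₂⟩ := v
    have h1 : v₁ = 0 := by
      have := congrArg Prod.fst hv
      simpa using this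
    subst h1
    have h2 : fderiv ℝ S (p, x) ((0 : P), v₂) = 0 := by
      have := congrArg Prod.snd hv
      simpa using this
    have h3 : D v₂ = 0 := by
      rw [← hpart]
      simpa using h2
    have h4 : min (c / 2) 1 * ‖v₂‖ ≤ 0 := by simpa [h3] using hDlow v₂
    have h5 : ‖v₂‖ ≤ 0 := by
      by_contra hneg
      have : 0 < min (c / 2) 1 * ‖v₂‖ := mul_pos hm (lt_of_not_ge hneg)
      linarith
    have h6 : v₂ = 0 := norm_le_zero_iff.1 h5
    rw [h6]; rfl
  set A := (ContinuousLinearMap.fst ℝ P E).prod (fderiv ℝ S (p, x)) with hA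
  set M : (P × E) ≃L[ℝ] (P × E) :=
    (LinearMap.linearEquivOfInjective (A : P × E →ₗ[ℝ] P × E) hinj rfl).toContinuousLinearEquiv
    with hM
  refine ⟨M, ?_⟩
  have hcoe : (M : P × E →L[ℝ] P × E) = A := by
    ext v <;> rfl
  rw [hcoe]
  exact hTd

/-- **The family of inverses of the spliced family is jointly `C^∞`.** Let `V` be an open set
of parameters at each of which `θ_p` is an inner collar satisfying `SpliceHyp … L`. Then there is
a map `Θinv : P → E → E`, jointly `C^∞` on `V × 𝔹`, with `Θinv p` the inverse of the splice
`Θ_p` on the open unit ball for every `p ∈ V` (inverse function theorem for the track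
`(p, x) ↦ (p, Θ_p x)`, a `C^∞` bijection of `V × 𝔹` with invertible derivative, through
`OpenPartialHomeomorph.contDiffAt_symm`). [folklore] -/
theorem exists_spliceInverse_family (hF : ContDiff ℝ ∞ fun q : P × E => θf q.1 q.2) {L : ℝ}
    {V : Set P} (hVo : IsOpen V)
    (hV : ∀ p ∈ V, IsInnerCollar ε (θf p) (θinv p) ∧ ∃ ε₃ c C₁ : ℝ, SpliceHyp ε (θf p) ε₃ c C₁ L) :
    ∃ Θinv : P → E → E,
      ContDiffOn ℝ ∞ (fun q : P × E => Θinv q.1 q.2) (V ×ˢ ball (0 : E) 1) ∧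
      (∀ p ∈ V, ∀ y ∈ ball (0 : E) 1,
        Θinv p y ∈ ball (0 : E) 1 ∧ splice (θf p) L (Θinv p y) = y) ∧
      (∀ p ∈ V, ∀ x ∈ ball (0 : E) 1, Θinv p (splice (θf p) L x) = x) := by
  classical
  by_cases hVne : V.Nonempty
  swap
  · -- no good parameters: nothing to do
    rw [not_nonempty_iff_eq_empty] at hVne
    subst hVne
    exact ⟨fun _ y => y, by simp [contDiffOn_empty.mono], by simp, by simp⟩
  obtain ⟨p₁, hp₁⟩ := hVne
  have hL : 0 < L := by
    obtain ⟨-, ε₃, c, C₁, hs⟩ := hV p₁ hp₁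
    exact hs.L_pos
  set T : P × E → P × E := fun q => (q.1, splice (θf q.1) L q.2) with hT
  set S : Set (P × E) := V ×ˢ ball (0 : E) 1 with hS
  have hSo : IsOpen S := hVo.prod isOpen_ball
  -- `T` is a bijection of `S`
  have hmaps : MapsTo T S S := by
    rintro ⟨p, x⟩ ⟨hp, hx⟩
    obtain ⟨h, ε₃, c, C₁, hs⟩ := hV p hp
    exact ⟨hp, hs.mapsTo_splice h hx⟩
  have hinj : InjOn T S := by
    rintro ⟨p, x⟩ ⟨hp, hx⟩ ⟨p', x'⟩ ⟨-, hx'⟩ hq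
    simp only [hT, Prod.mk.injEq] at hq
    obtain ⟨rfl, hq2⟩ := hq
    obtain ⟨h, ε₃, c, C₁, hs⟩ := hV p hp
    exact Prod.ext rfl (hs.injOn_splice hx hx' hq2)
  have hsurj : SurjOn T S S := by
    rintro ⟨p, y⟩ ⟨hp, hy⟩
    obtain ⟨h, ε₃, c, C₁, hs⟩ := hV p hp
    obtain ⟨x, hx, hxy⟩ := hs.surjOn_splice h hy
    exact ⟨(p, x), ⟨hp, hx⟩, Prod.ext rfl hxy⟩
  have hbij : BijOn T S S := ⟨hmaps, hinj, hsurj⟩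
  have hcont : ContinuousOn T S := fun q hq =>
    (contDiffAt_spliceTrack hF hL (mem_ball_zero_iff.1 hq.2)).continuousAt.continuousWithinAt
  -- strict derivatives which are equivalences, at every point of `S`
  have hstrict : ∀ q ∈ S, ∃ M : (P × E) ≃L[ℝ] (P × E),
      HasStrictFDerivAt T (M : P × E →L[ℝ] P × E) q := by
    rintro ⟨p, x⟩ ⟨hp, hx⟩
    obtain ⟨h, ε₃, c, C₁, hs⟩ := hV p hp
    obtain ⟨M, hM⟩ := exists_hasFDerivAt_spliceTrack_equiv hF h hs (mem_ball_zero_iff.1 hx)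
    exact ⟨M, (contDiffAt_spliceTrack hF hL (q := (p, x)) (mem_ball_zero_iff.1 hx)).hasStrictFDerivAt'
      hM (by simp)⟩
  have hopen : IsOpenMap (S.restrict T) := by
    intro U hU
    rw [restrict_eq, image_comp]
    have hval : IsOpen (Subtype.val '' U) := hSo.isOpenMap_subtype_val U hU
    refine isOpen_iff_mem_nhds.2 ?_
    rintro _ ⟨q, hqU, rfl⟩
    obtain ⟨q', hq'U, rfl⟩ := hqU
    obtain ⟨M, hM⟩ := hstrict q' q'.2
    rw [← hM.map_nhds_eq_of_equiv]
    exact image_mem_map (hval.mem_nhds ⟨q', hq'U, rfl⟩)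
  haveI : Nonempty (P × E) := ⟨(p₁, 0)⟩
  set 𝒯 : OpenPartialHomeomorph (P × E) (P × E) :=
    OpenPartialHomeomorph.ofContinuousOpenRestrict (hbij.toPartialEquiv T S S) hcont hopen hSo
    with h𝒯
  have h𝒯coe : ⇑𝒯 = T := rfl
  have h𝒯src : 𝒯.source = S := rfl
  have h𝒯tgt : 𝒯.target = S := rfl
  -- the first component of the inverse is the parameter
  have hfst : ∀ q ∈ S, (𝒯.symm q).1 = q.1 := by
    intro q hq
    have h1 : 𝒯 (𝒯.symm q) = q := 𝒯.right_inv (by rw [h𝒯tgt]; exact hq)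
    have h2 : (𝒯 (𝒯.symm q)).1 = (𝒯.symm q).1 := rfl
    rw [← h2, h1]
  refine ⟨fun p y => (𝒯.symm (p, y)).2, ?_, ?_, ?_⟩
  · -- joint smoothness of the inverse
    intro q hq
    have hq' : q ∈ 𝒯.target := by rw [h𝒯tgt]; exact hq
    have hsq : 𝒯.symm q ∈ S := by rw [← h𝒯src]; exact 𝒯.map_target hq'
    obtain ⟨M, hM⟩ := hstrict _ hsq
    have hsm : ContDiffAt ℝ ∞ 𝒯.symm q :=
      𝒯.contDiffAt_symm hq' hM.hasFDerivAt
        (contDiffAt_spliceTrack hF hL (mem_ball_zero_iff.1 hsq.2))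
    have hc2 : ContDiffAt ℝ ∞ (Prod.snd ∘ 𝒯.symm) q := contDiffAt_snd.comp q hsm
    exact (hc2.congr_of_eventuallyEq (Eventually.of_forall fun r => rfl)).contDiffWithinAt
  · intro p hp y hy
    have hq : (p, y) ∈ S := ⟨hp, hy⟩
    have hq' : (p, y) ∈ 𝒯.target := by rw [h𝒯tgt]; exact hq
    have hsq : 𝒯.symm (p, y) ∈ S := by rw [← h𝒯src]; exact 𝒯.map_target hq'
    have h1 : 𝒯 (𝒯.symm (p, y)) = (p, y) := 𝒯.right_inv hq'
    have hp' : (𝒯.symm (p, y)).1 = p := hfst (p, y) hq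
    refine ⟨?_, ?_⟩
    · exact hsq.2
    · have h2 := congrArg Prod.snd h1
      rw [h𝒯coe] at h2
      simp only [hT] at h2
      rw [hp'] at h2
      exact h2
  · intro p hp x hx
    have hq : (p, x) ∈ 𝒯.source := by rw [h𝒯src]; exact ⟨hp, hx⟩
    have h1 : 𝒯.symm (𝒯 (p, x)) = (p, x) := 𝒯.left_inv hq
    have h2 := congrArg Prod.snd h1
    rw [h𝒯coe] at h2
    simpa [hT] using h2

end Families

end IsInnerCollar

end Literature.Topology.FourManifolds
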